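import Literature.IUT.HodgeArakelov.ThetaMonoidsMultiradialFunctor
import Literature.IUT.HodgeArakelov.ThetaEnvDataRecordModel
import HarnessLib

/-!
# [IUTchII] Proposition 3.4 (i): NON-VACUITY of the output category `ThetaMonoidDatum` of the functorial algorithm
# `Π_v ↦ (Π_v ↷ Ψ_env(M^Θ_*(Π_v)))` — degenerate, transport-parametric, and GENUINE (the natural system of `X̲̲_K`)

Mochizuki, *Inter-universal Teichmüller theory II*, kurims manuscript (Dec. 2020), §3, Proposition 3.4 (i), p. 91
(the functorial algorithms `Π_v ↦ Ψ_env(M^Θ_*(Π_v))`, `Π_v ↦ ∞Ψ_env(M^Θ_*(Π_v))`) and Proposition 3.1 (i), p. 87 (the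
input data `lim_J H¹(…)`, `θ^ι_env`) [claim: Mochizuki2012, status: disputed] (D-0012 claim key; record-only vocabulary;
this file takes no side).

abc-iut cell, layer L6, NON-VACUITY CERTIFICATE (INHABITATION CENSUS L6 v4, class (A): "`ThetaMonoidDatum` — NEW structure
since v3, 0 producers"; plan/ADJUDICATION-SPEC §4 (iii)) for abc-iut-w5-d169's `TemperedThetaMonoids.ThetaMonoidDatum S`
(`ThetaMonoidsMultiradialFunctor.lean`): pairs `(Π, E)` of an isomorph `Π` of `Π^tp_{X̲̲_k}` and theta-environment data
`E` on it — the TARGET category of `thetaMonoidFunctor` / `prop34iRadialFunctor` (junction J12,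
`prop34i_multiradiallyDefined`).  The census counts only constants whose type ends in the structure, and the tree's
producers are functor VALUES (`(thetaMonoidFunctor T).obj P`), hence "0 producers"; the kernel facts are:

* `ThetaMonoidDatum.nonempty_of_transport` — every transport input `T : ThetaEnvTransport S` (J10) and every isomorph
  `P` give the output object `(thetaMonoidFunctor T).obj P` (so the category is inhabited as soon as J10 is — in
  particular at `ThetaEnvTransport.trivial`, and at abc-iut-w5-d169's `ThetaEnvTransport.ofAutAction E₀ A`);
* `ThetaMonoidDatum.nonempty_of_data` / `nonempty_of_refData` — any theta-environment datum on any isomorph (resp. on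
  the reference group `Π^tp_{X̲̲_k}` itself, `IsoClass.base`) is an object;
* `ThetaMonoidDatum.nonempty` — hence the type is inhabited over EVERY `S` (DEGENERATE label: via
  `ThetaEnvTransport.trivialData`, trivial module, empty theta sets);
* `ThetaMonoidDatum.nonempty_model` — the **GENUINE** witness: at the [IUTchII] §1 setting `EtaleLevels.setting C …` of
  `X̲̲_K` built from an [EtTh] theta setting (abc-iut-L2/L6 bridge lineage), the object `(Π^tp_{X̲̲_K}, thetaEnvRecord …)`
  whose datum is abc-iut-w4-d019's Prop. 3.1 input RECORD of the NATURAL projective system `𝕄_*(X̲̲_K)`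
  (`EtaleLevels.thetaEnvRecord`, ambient module `lim_J H¹(Π^tp_{Ÿ̲̲} ∩ J, l·Δ_Θ)`, conjugation action, a Kummer map `κ`
  of the constant monoid, the inversion family of `ι₀`) — under exactly that record's standing hypotheses, nothing
  added; `Π_X(𝕄_*) = Π^tp_{X̲̲}` on the nose (`modelRecon_PiX`, `rfl`), so no transport is needed.
Theorems only: no `def`, no `instance`, no `Prop` fact; nothing here bears on [IUTchIII] Cor. 3.12.
-/

namespace Literature.IUT.HodgeArakelov

open CategoryTheory Literature.AnabelianGeometry.AbsoluteAnabelian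

universe u

namespace TemperedThetaMonoids

namespace ThetaMonoidDatum

variable (S : ThetaSetting.{u})

/-- **Every transport input and every isomorph give an output object of the Prop. 3.4 (i) functor** — the category
`ThetaMonoidDatum S` is inhabited by `(thetaMonoidFunctor T).obj P = (P, T.E P)`. [cite: Mochizuki2012, II Prop 3.4 (i) p.91] -/
theorem nonempty_of_transport (T : ThetaEnvTransport S) (P : IsoClass S.PiX) : Nonempty (ThetaMonoidDatum S) :=
  ⟨(thetaMonoidFunctor T).obj P⟩

/-- Any theta-environment datum on any isomorph of `Π^tp_{X̲̲_k}` is an object. [cite: Mochizuki2012, II Prop 3.4 (i) p.91] -/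
theorem nonempty_of_data (P : IsoClass S.PiX) (E : ThetaEnvData.{u, u} P.G) : Nonempty (ThetaMonoidDatum S) :=
  ⟨⟨P, E⟩⟩

/-- Any theta-environment datum on the reference group `Π^tp_{X̲̲_k}` itself is an object (isomorph `IsoClass.base`).
[cite: Mochizuki2012, II Prop 3.4 (i) p.91] -/
theorem nonempty_of_refData (E₀ : ThetaEnvData.{u, u} S.PiX) : Nonempty (ThetaMonoidDatum S) :=
  ⟨⟨IsoClass.base S.PiX, E₀⟩⟩

/-- **DEGENERATE inhabitant over every setting**: the reference group with the degenerate datum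
`ThetaEnvTransport.trivialData` (trivial ambient module, one inversion index, empty theta sets) — equivalently
`(thetaMonoidFunctor ThetaEnvTransport.trivial).obj (IsoClass.base _)`. Interface non-vacuity only.
[cite: Mochizuki2012, II Prop 3.4 (i) p.91] -/
theorem nonempty : Nonempty (ThetaMonoidDatum S) :=
  nonempty_of_transport S (ThetaEnvTransport.trivial S) (IsoClass.base S.PiX)

/-- The projection to the isomorph is surjective: every isomorph `Π` of `Π^tp_{X̲̲_k}` underlies some object (the
functor is defined on all of `IsoClass S.PiX`). [cite: Mochizuki2012, II Prop 3.4 (i) p.91] -/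
theorem exists_P_eq (T : ThetaEnvTransport S) (P : IsoClass S.PiX) : ∃ X : ThetaMonoidDatum S, X.P = P :=
  ⟨(thetaMonoidFunctor T).obj P, rfl⟩

end ThetaMonoidDatum

end TemperedThetaMonoids

/-! ## The GENUINE witness: the natural system of `X̲̲_K` ([IUTchII] Prop. 3.1 input record of abc-iut-w4-d019) -/

namespace EtaleLevels

open Literature.AnabelianGeometry.EtaleTheta CohomologySystemOfContH1 EtaleThetaDataOfSetting

variable {p : ℕ} [Fact p.Prime] {D : Literature.AnabelianGeometry.EtaleTheta.ThetaSetting p}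
  {E : D.EtaleThetaData} {l : ℕ} (C : E.DoubleUnderline l) (hC : D.Compat) (hS : D.Sec2Hyps)
  (hl : l.Prime) (hp2 : p ≠ 2) (hpl : p ≠ l) (hζ : ∃ ζ : D.K, IsPrimitiveRoot ζ (4 * l))
  (mods : ∀ M : ℕ+, D.CyclotomeMod l M)
  (f : contCocycles D.toTheta D.DeltaTheta C.GtpYdduu) (hf : f ∈ C.rootCocycles hC)
  (hmods : ∀ (M M' : ℕ+) (h : (M : ℕ) ∣ (M' : ℕ)) (x : D.lDeltaTheta l),
    MuN.red p M M' h ((mods M').red x) = (mods M).red x)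
  (h15 : Literature.AnabelianGeometry.EtaleTheta.ThetaSetting.Prop15iii E hC) (L : C.CuspLabels)
  (hZ : ∀ M : ℕ+, Nonempty (ModelCyclotomes.lDeltaQuot (C.rigidData (mods M) hC hS h15 L) ≃*
    Literature.IUT.HodgeTheaters.ZHat))
  (hcharY : EtaleThetaDataOfSetting.PiYddCharacteristic C)
  (hlim : Function.Bijective (rigidLimHom C hC hS hl hp2 hpl hζ mods f hf hmods h15 L hZ))
  [(EtaleThetaDataOfSetting.PiYdd C).Normal]

include hmods h15 L hZ hcharY hlim in
/-- **GENUINE inhabitant of `ThetaMonoidDatum`** at the [IUTchII] §1 setting of `X̲̲_K` (`EtaleLevels.setting C …`, the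
level-`1` `ThetaSetting.ofDoubleUnderline` of the [EtTh] data): the object `(Π^tp_{X̲̲_K}, thetaEnvRecord … κ ι₀)` — the
reference isomorph `IsoClass.base` carrying abc-iut-w4-d019's Prop. 3.1 input RECORD of the natural projective system
`𝕄_*(X̲̲_K)` (ambient module `lim_J H¹(Π^tp_{Ÿ̲̲} ∩ J, l·Δ_Θ)`, conjugation action, Kummer map `κ` of the constant monoid,
inversion family of `ι₀`), under that record's own hypotheses and nothing more (`Π_X(𝕄_*) = Π^tp_{X̲̲}` on the nose, so
the record IS a datum on `(IsoClass.base _).G`). [cite: Mochizuki2012, II Prop 3.1 (i) p.87] -/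
theorem nonempty_thetaMonoidDatum_model {M : Type} [CommMonoid M]
    (κ : M →* Multiplicative (h1Lim (phi C) (D.lDeltaTheta l) (PiYdd C) ⊥)) (ι₀ : Pi C) :
    Nonempty (TemperedThetaMonoids.ThetaMonoidDatum (setting C hC hS hl hp2 hpl hζ mods f hf)) :=
  ⟨⟨IsoClass.base _, thetaEnvRecord C hC hS hl hp2 hpl hζ mods f hf hmods h15 L hZ hcharY hlim κ ι₀⟩⟩

/-- The genuine object's isomorph component is the reference `Π^tp_{X̲̲_K}` and its datum component is the record
(read-back for consumers). [cite: Mochizuki2012, II Prop 3.1 (i) p.87] -/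
theorem exists_thetaMonoidDatum_model_eq {M : Type} [CommMonoid M]
    (κ : M →* Multiplicative (h1Lim (phi C) (D.lDeltaTheta l) (PiYdd C) ⊥)) (ι₀ : Pi C) :
    ∃ X : TemperedThetaMonoids.ThetaMonoidDatum (setting C hC hS hl hp2 hpl hζ mods f hf),
      X.P = IsoClass.base _ ∧
        HEq X.E (thetaEnvRecord C hC hS hl hp2 hpl hζ mods f hf hmods h15 L hZ hcharY hlim κ ι₀) :=
  ⟨⟨IsoClass.base _, thetaEnvRecord C hC hS hl hp2 hpl hζ mods f hf hmods h15 L hZ hcharY hlim κ ι₀⟩, rfl, HEq.rfl⟩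

end EtaleLevels

end Literature.IUT.HodgeArakelov
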